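import Mathlib
import Summits.AtomisticToContinuum.Crystallization.Theses.HullMinimality
import Literature.MathematicalPhysics.StatisticalMechanics.LennardJonesClusters
import Literature.MathematicalPhysics.StatisticalMechanics.CrystallizationLocalLimit

/-!
# The hull criterion: periodic windows imply Blanc–Lewin crystallization
(line `prestress-split-korn`, statement block S7; item `stmt-AtomisticToContinuum-3243` by name)

Crux `stmt-AtomisticToContinuum-13603` (`ReggeStarCoercivity.DefectFreeCrystallizes`),
stub `stub_hullCriterion`, whose type is literally `HullMinimality.HullCriterion`
(`PeriodicWindows → IsCrystallizing lennardJones 3`).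

PROOF. Fix a sequence of Lennard-Jones ground states `x` and the periodic configuration `P` given by
`PeriodicWindows`. For every `j : ℕ` the hypothesis at scale `(R, ε) = (j+1, 1/(j+1))` gives,
frequently in `N`, a translation `t` two-way `1/(j+1)`-matching `x N + t` with `P.points` on the
ball of radius `j+1`; `Filter.extraction_forall_of_frequently` extracts a strictly increasing
`φ` with this property at `N = φ j` for every `j`, and `choose` gives the translations `τ j`.
The translated ground states `y j i := x (φ j) i + τ j` keep the uniform minimal distance `δ > 0` of
`LennardJonesMinimalDistance_holds` (translations are isometries), and matching at scale
`(j+1, 1/(j+1))` implies matching at any fixed scale `(R, ε)` as soon as `R ≤ j+1` and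
`1/(j+1) ≤ ε`, i.e. eventually in `j`. `PeriodicConfiguration.tendsto_sum_of_eventually_near`
(`CrystallizationLocalLimit.lean`) then gives the local convergence
`∑ᵢ f(y j i) → ∑' s : P.points, f s` for every continuous compactly supported `f`, which is the
convergence clause of `IsCrystallizing` with multiplicity `m ≡ 1` (so `1 ≤ m` and lattice
invariance of `m` are trivial).
-/

noncomputable section

namespace Summit.AtomisticToContinuum.Crystallization.Theorems.PrestressSplitKorn

open Summit.AtomisticToContinuum.Crystallization.Theses
open Literature.MathematicalPhysics.StatisticalMechanics
open Filter Topology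

/-- Monotonicity of two-way matching in the scale: a two-way `ε'`-matching on the ball of radius
`R'` between a finite configuration `y` and a set `S` is a two-way `ε`-matching on the ball of
radius `R` whenever `R ≤ R'` and `ε' ≤ ε`. -/
theorem hull_match_mono {n : ℕ} {y : Fin n → EuclideanSpace ℝ (Fin 3)}
    {S : Set (EuclideanSpace ℝ (Fin 3))} {R R' ε ε' : ℝ} (hR : R ≤ R') (hε : ε' ≤ ε)
    (h : (∀ s ∈ S, ‖s‖ ≤ R' → ∃ i, dist (y i) s ≤ ε') ∧
      (∀ i, ‖y i‖ ≤ R' → ∃ s ∈ S, dist (y i) s ≤ ε')) :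
    (∀ s ∈ S, ‖s‖ ≤ R → ∃ i, dist (y i) s ≤ ε) ∧
      (∀ i, ‖y i‖ ≤ R → ∃ s ∈ S, dist (y i) s ≤ ε) := by
  refine ⟨fun s hs hsR => ?_, fun i hi => ?_⟩
  · obtain ⟨i, hi⟩ := h.1 s hs (hsR.trans hR)
    exact ⟨i, hi.trans hε⟩
  · obtain ⟨s, hs, hds⟩ := h.2 i (hi.trans hR)
    exact ⟨s, hs, hds.trans hε⟩

/-- Eventually in `j : ℕ`, the scale `(j+1, 1/(j+1))` dominates a fixed scale `(R, ε)` with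
`ε > 0`: `R ≤ j+1` and `1/(j+1) ≤ ε`. -/
theorem hull_eventually_scale (R ε : ℝ) (hε : 0 < ε) :
    ∀ᶠ j : ℕ in atTop, R ≤ (j : ℝ) + 1 ∧ 1 / ((j : ℝ) + 1) ≤ ε := by
  obtain ⟨J, hJ⟩ := exists_nat_ge (max R (1 / ε))
  filter_upwards [eventually_ge_atTop J] with j hj
  have hjJ : (J : ℝ) ≤ j := by exact_mod_cast hj
  have hR : R ≤ (j : ℝ) + 1 := by linarith [le_max_left R (1 / ε)]
  have h1 : 1 / ε ≤ (j : ℝ) + 1 := by linarith [le_max_right R (1 / ε)]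
  refine ⟨hR, ?_⟩
  rw [div_le_iff₀ (by positivity)]
  rw [div_le_iff₀ hε] at h1
  linarith

/-- **S7 `stub_hullCriterion`** (= `HullMinimality.HullCriterion`, item stmt-AtomisticToContinuum-3243,
verbatim): periodic windows at every scale, frequently in `N`, imply the Blanc–Lewin crystallization
statement `IsCrystallizing lennardJones 3` (local convergence of translated ground states along a
subsequence to the multiplicity-one periodic point measure of `P`). Diagonal extraction over the
scales `(j+1, 1/(j+1))` (`Filter.extraction_forall_of_frequently`), uniform minimal distance of
Lennard-Jones ground states (`LennardJonesMinimalDistance_holds`), and the local-limit criterion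
`PeriodicConfiguration.tendsto_sum_of_eventually_near`. -/
theorem stub_hullCriterion : HullMinimality.HullCriterion := by
  intro hPW x hx
  obtain ⟨P, hP⟩ := hPW x hx
  -- (1) diagonal extraction over the scales `(j+1, 1/(j+1))`
  have hfreq : ∀ j : ℕ, ∃ᶠ N in atTop, ∃ t : EuclideanSpace ℝ (Fin 3),
      (∀ s ∈ P.points, ‖s‖ ≤ (j : ℝ) + 1 → ∃ i : Fin N, dist (x N i + t) s ≤ 1 / ((j : ℝ) + 1)) ∧
      (∀ i : Fin N, ‖x N i + t‖ ≤ (j : ℝ) + 1 →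
        ∃ s ∈ P.points, dist (x N i + t) s ≤ 1 / ((j : ℝ) + 1)) :=
    fun j => hP ((j : ℝ) + 1) (1 / ((j : ℝ) + 1)) (by positivity)
  obtain ⟨φ, hφ, hφQ⟩ := Filter.extraction_forall_of_frequently hfreq
  choose τ hτ using hφQ
  -- (2) uniform separation of the translated ground states
  obtain ⟨δ, hδ, hsep⟩ := LennardJonesMinimalDistance_holds
  have hsep' : ∀ (j : ℕ) (i i' : Fin (φ j)), i ≠ i' →
      δ ≤ dist (x (φ j) i + τ j) (x (φ j) i' + τ j) := fun j i i' hii' => by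
    rw [dist_add_right]
    exact hsep (φ j) (x (φ j)) (hx (φ j)) i i' hii'
  -- (3) eventual matching at every fixed scale
  have hmatch : ∀ R ε : ℝ, 0 < ε → ∀ᶠ j in atTop,
      (∀ s ∈ P.points, ‖s‖ ≤ R → ∃ i : Fin (φ j), dist (x (φ j) i + τ j) s ≤ ε) ∧
      (∀ i : Fin (φ j), ‖x (φ j) i + τ j‖ ≤ R → ∃ s ∈ P.points, dist (x (φ j) i + τ j) s ≤ ε) :=
    fun R ε hε => by
      filter_upwards [hull_eventually_scale R ε hε] with j hj
      exact hull_match_mono (y := fun i => x (φ j) i + τ j) hj.1 hj.2 (hτ j)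
  -- (4) conclude with multiplicity `m ≡ 1`
  refine ⟨φ, τ, P, fun _ => 1, hφ, fun _ _ => le_rfl, fun _ _ _ => rfl, fun f hfc hf => ?_⟩
  simpa using P.tendsto_sum_of_eventually_near (fun j i => x (φ j) i + τ j) hδ hsep' hmatch hfc hf

end Summit.AtomisticToContinuum.Crystallization.Theorems.PrestressSplitKorn

end
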